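import Mathlib
import Literature.Analysis.FunctionSpaces.SobolevDomainPoincareProofs
import Literature.Analysis.Complex.PlanePotentialEstimates
import HarnessLib

/-!
# Crux `EulerZoomLiouville.PowerGaugeEulerLiouville` (stmt-NavierStokesRegularity-19832), line `swirl-capacity`, stub D2 — tool 1:
# THE RAY POTENTIAL BOUND IN THE PLANE

Route №10 `EulerZoomLiouville` (NavierStokesRegularity), crux E.  Line `swirl-capacity` (ideator ns-idea-11 g3;
`Cruxes/PowerGaugeEulerLiouville/Lines/swirl_capacity.lean`), registered stub `stub_axisCapacityFloor` (D2, THE LEVER: the axis capacity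
floor `∫_{B(0,3A)} |∇f|²/r² ≥ K γ₀² / (A (1 + log⁺(A³/V)))`).  The planned proof of D2 is the planar LOGARITHMIC CAPACITY lower bound by
potential duality (meridional reduction → cut-off → ray potential bound → Tonelli + Cauchy–Schwarz against the two-pole logarithmic
estimate); this file lands its first tool:

* **`two_pi_mul_enorm_le_lintegral_fderiv_div`** — for `φ ∈ C¹(ℂ; ℝ)` supported in a disc and every `y ∈ ℂ`,
  `2π |φ(y)| ≤ ∫ ‖∇φ(x)‖ / |x − y| dA(x)`: the fundamental theorem of calculus along every ray from `y`
  (the tree's `SobolevDomainPoincareProofs.enorm_le_lintegral_fderiv_line`, in each direction), averaged over the directions and rewritten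
  in polar coordinates about `y` (Mathlib's `Complex.lintegral_comp_polarCoord_symm`; the Jacobian `r` cancels the kernel `1/r`).

WHAT THIS IS NOT: not NS, not the crux, not yet D2 — a `--supports` tool for stmt-19832 (pure real analysis in the plane); no summit
statement is proved here.  [cite: AdamsSobolevSpaces1975, ¶6.26 (the ray representation); GilbargTrudinger2001, Lemma 7.14]
-/

noncomputable section

-- flat `Theorems/<Route><Decl>…` files of one crux share the namespace of the crux (tree convention)
set_option linter.dupNamespace false

open MeasureTheory Set Filter Topology Metric Function
open scoped NNReal ENNReal Real

namespace Summit.NavierStokesRegularity.NavierStokesRegularity.Theorems.PowerGaugeEulerLiouville.SwirlCapacity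

/-- **The ray potential bound** (fundamental theorem of calculus along every ray, averaged over the directions): for
`φ ∈ C¹(ℂ; ℝ)` supported in the disc `B̄(0, ρ)` and every `y ∈ ℂ`, `2π |φ(y)| ≤ ∫ ‖∇φ(x)‖ / |x − y| dA(x)` (in `ℝ≥0∞`).
[cite: GilbargTrudinger2001, Lemma 7.14] -/
theorem two_pi_mul_enorm_le_lintegral_fderiv_div {φ : ℂ → ℝ} (hφ : ContDiff ℝ 1 φ) {ρ : ℝ} (hρ : 0 ≤ ρ)
    (hsupp : tsupport φ ⊆ closedBall (0 : ℂ) ρ) (y : ℂ) :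
    ENNReal.ofReal (2 * π) * ‖φ y‖ₑ ≤ ∫⁻ x, ‖fderiv ℝ φ x‖ₑ * ‖x - y‖ₑ⁻¹ := by
  -- the integrand in polar coordinates about `y`
  set G : ℝ × ℝ → ℝ≥0∞ := fun p => ‖fderiv ℝ φ (y + p.1 * (Real.cos p.2 + Real.sin p.2 * Complex.I))‖ₑ with hG
  have hGm : Measurable G := by
    have hc : Continuous fun p : ℝ × ℝ => fderiv ℝ φ (y + p.1 * (Real.cos p.2 + Real.sin p.2 * Complex.I)) := by
      refine (hφ.continuous_fderiv one_ne_zero).comp ?_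
      fun_prop
    exact hc.measurable.enorm
  -- step 1: along every ray
  have hray : ∀ θ : ℝ, ‖φ y‖ₑ ≤ ∫⁻ r in Ioi (0 : ℝ), G (r, θ) := by
    intro θ
    set v : ℂ := -(Real.cos θ + Real.sin θ * Complex.I) with hv
    have hv1 : ‖v‖ = 1 := by
      rw [hv, norm_neg]
      have h := Complex.norm_cos_add_sin_mul_I θ
      rwa [← Complex.ofReal_cos, ← Complex.ofReal_sin] at h
    have h := Literature.Analysis.FunctionSpaces.enorm_le_lintegral_fderiv_line hφ hρ hsupp hv1 y
    refine h.trans ((lintegral_mono_set Icc_subset_Iic_self).trans (le_of_eq ?_))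
    -- reflect `t ↦ -t`
    have hneg : ∫⁻ t in Iic (0 : ℝ), ‖fderiv ℝ φ (y + t • v)‖ₑ = ∫⁻ r in Ici (0 : ℝ), ‖fderiv ℝ φ (y + (-r) • v)‖ₑ := by
      rw [← lintegral_indicator measurableSet_Iic, ← lintegral_indicator measurableSet_Ici,
        ← lintegral_neg_eq_self (μ := (volume : Measure ℝ))
          ((Iic (0 : ℝ)).indicator fun t => ‖fderiv ℝ φ (y + t • v)‖ₑ)]
      refine lintegral_congr fun r => ?_
      by_cases hr : r ∈ Ici (0 : ℝ)
      · rw [indicator_of_mem hr, indicator_of_mem (show -r ∈ Iic (0 : ℝ) by simpa using hr)]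
      · rw [indicator_of_notMem hr, indicator_of_notMem (show -r ∉ Iic (0 : ℝ) by simpa using hr)]
    rw [hneg, setLIntegral_congr Ioi_ae_eq_Ici.symm]
    refine setLIntegral_congr_fun measurableSet_Ioi fun r _ => ?_
    simp only [hG, hv, smul_neg, neg_smul, neg_neg, Complex.real_smul]
  -- step 2: integrate over the directions
  have hconst : ENNReal.ofReal (2 * π) * ‖φ y‖ₑ = ∫⁻ _ in Ioo (-π) π, ‖φ y‖ₑ := by
    rw [setLIntegral_const, Real.volume_Ioo, show π - -π = 2 * π by ring, mul_comm]
  rw [hconst]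
  calc ∫⁻ _ in Ioo (-π) π, ‖φ y‖ₑ ≤ ∫⁻ θ in Ioo (-π) π, ∫⁻ r in Ioi (0 : ℝ), G (r, θ) :=
        lintegral_mono fun θ => hray θ
    _ = ∫⁻ p in Ioi (0 : ℝ) ×ˢ Ioo (-π) π, G p := by
        have hμ : ((volume : Measure ℝ).restrict (Ioi 0)).prod ((volume : Measure ℝ).restrict (Ioo (-π) π)) =
            (volume : Measure (ℝ × ℝ)).restrict (Ioi (0 : ℝ) ×ˢ Ioo (-π) π) := by
          rw [Measure.prod_restrict, ← Measure.volume_eq_prod]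
        rw [← hμ, lintegral_prod_symm _ hGm.aemeasurable]
    _ = ∫⁻ p in polarCoord.target, ENNReal.ofReal p.1 •
          ((fun x : ℂ => ‖fderiv ℝ φ (y + x)‖ₑ * ‖x‖ₑ⁻¹) (Complex.polarCoord.symm p)) := by
        rw [show (polarCoord.target : Set (ℝ × ℝ)) = Ioi (0 : ℝ) ×ˢ Ioo (-π) π from rfl]
        refine setLIntegral_congr_fun (measurableSet_Ioi.prod measurableSet_Ioo) fun p hp => ?_
        have hp1 : 0 < p.1 := hp.1
        have hnorm : ‖Complex.polarCoord.symm p‖ₑ = ENNReal.ofReal p.1 := by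
          rw [← ofReal_norm, Complex.norm_polarCoord_symm, abs_of_pos hp1]
        have h0 : ENNReal.ofReal p.1 ≠ 0 := (ENNReal.ofReal_pos.2 hp1).ne'
        show G p = ENNReal.ofReal p.1 • (‖fderiv ℝ φ (y + Complex.polarCoord.symm p)‖ₑ * ‖Complex.polarCoord.symm p‖ₑ⁻¹)
        rw [hnorm, smul_eq_mul, Complex.polarCoord_symm_apply, hG]
        rw [mul_comm (ENNReal.ofReal p.1), mul_assoc, ENNReal.inv_mul_cancel h0 ENNReal.ofReal_ne_top, mul_one]
    _ = ∫⁻ x, ‖fderiv ℝ φ (y + x)‖ₑ * ‖x‖ₑ⁻¹ :=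
        Complex.lintegral_comp_polarCoord_symm (fun x : ℂ => ‖fderiv ℝ φ (y + x)‖ₑ * ‖x‖ₑ⁻¹)
    _ = ∫⁻ x, ‖fderiv ℝ φ x‖ₑ * ‖x - y‖ₑ⁻¹ := by
        rw [← lintegral_add_right_eq_self (μ := (volume : Measure ℂ)) (fun x => ‖fderiv ℝ φ x‖ₑ * ‖x - y‖ₑ⁻¹) y]
        refine lintegral_congr fun x => ?_
        simp only [add_sub_cancel_left, add_comm x y]

end Summit.NavierStokesRegularity.NavierStokesRegularity.Theorems.PowerGaugeEulerLiouville.SwirlCapacity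

end
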